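import Literature.MathematicalPhysics.QuantumFieldTheory.GaussianToolkit
import Literature.Algebra.EuclideanLattices.GaussianLatticeSums
import Literature.Algebra.EuclideanLattices.IntegerBases
import Literature.Algebra.EuclideanLattices.GaussLattice3D
import HarnessLib

/-!
# Poisson summation for anisotropic Gaussians over `ℤᴺ` (the theta transformation of the dual model)

Support file of the proof programme of the named fact
`Literature.MathematicalPhysics.QuantumFieldTheory.FrohlichSpencerU1PerimeterLawD4`.
Fröhlich–Spencer 1982, §2.5–2.6: the sums over integer potentials `α` of the Gaussian weights
`exp(-(1/2β)(dα, dα) - ε(α, α))` of the (regularised) dual `U(1)` model are rewritten, by the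
Poisson summation formula in every variable `α_xy ∈ ℤ` ((2.37)–(2.40)), as Gaussian integrals
against `∑_ρ e^{i ρ·α}` — i.e. as a dual sum of Gaussian characteristic functions of the integer
current densities `ρ` (monopoles). This file proves that transformation in closed form, for an
arbitrary positive definite precision matrix `P` on `ℝᴺ` and an arbitrary real centre `m`:

* `tsum_exp_neg_half_form_sub_eq` — **the theta transformation** (real form, indexed by `ℤᴺ`)
  `∑_{k ∈ ℤᴺ} e^{-½ (k-m)ᵀP(k-m)} = Z_P ∑_{ρ ∈ ℤᴺ} e^{-2π² ρᵀP⁻¹ρ} cos(2π ρ·m)`,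
  `Z_P = ∫ e^{-½ yᵀPy} dy` (`GaussianToolkit.gaussZ`), under explicit bounds `c ≤ P ≤ C`
  (`0 < c`, `0 < C`); complex form over the lattice `tsum_gauss_eq_complex`; summability of both
  sides `summable_gauss_stdIntLattice`, `summable_dual_complex`.

Ingredients, all from the tree and Mathlib: the Poisson summation formula for full lattices in
euclidean spaces (`Literature.NumberTheory.LFunctions.Fourier.tsum_eq_tsum_fourier_of_rpow_decay`),
here for the standard lattice `ℤᴺ ⊆ ℝᴺ` (`stdIntLattice`, enumerated by `stdIntLatticeEquiv`,
self-dual of covolume `1`: `dualLattice_stdIntLattice`, `covolume_stdIntLattice`), the density of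
Mathlib's `multivariateGaussian` (`GaussianToolkit.multivariateGaussian_inv_eq_withDensity`:
`integral_gauss_mul`) and its characteristic function
(`ProbabilityTheory.charFun_multivariateGaussian`), which together compute the Fourier transform of
the anisotropic Gaussian (`fourier_gauss`), and the bounds `c ≤ P ≤ C ⟹ C⁻¹ ≤ P⁻¹`
(`GaussianToolkit.inv_form_bounds`, `exp_neg_form_inv_le`) for the decay on both sides
(`gauss_le_gaussianFunction`). Everything is proved; no named fact is introduced.

## References

* J. Fröhlich, T. Spencer, Comm. Math. Phys. 83 (1982) 411–454, §2.5 (2.32)–(2.36), §2.6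
  (2.37)–(2.40). [FrohlichSpencerCMP1982]
-/

noncomputable section

open MeasureTheory Complex Module Matrix WithLp ProbabilityTheory Filter
open scoped Real FourierTransform InnerProductSpace ENNReal Topology
open Literature.Algebra.EuclideanLattices
open Literature.MathematicalPhysics.QuantumFieldTheory.GaussianToolkit

namespace Literature.MathematicalPhysics.QuantumFieldTheory

namespace GaussianPoisson

variable {N : ℕ}

/-! ### The standard lattice `ℤᴺ ⊆ ℝᴺ`: enumeration, self-duality, covolume -/

/-- The enumeration `ℤᴺ ≃ stdIntLattice N` by integer vectors. [folklore] -/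
def stdIntLatticeEquiv (N : ℕ) : (Fin N → ℤ) ≃ stdIntLattice N :=
  Equiv.ofBijective (fun k => ⟨intVecToEuclidean N k, intVecToEuclidean_mem_stdIntLattice N k⟩)
    ⟨fun k k' h => intVecToEuclidean_injective N (congrArg Subtype.val h), fun x => by
      choose k hk using (mem_stdIntLattice_iff x.1).1 x.2
      refine ⟨k, Subtype.ext ?_⟩
      ext j
      simp [intVecToEuclidean_apply, hk j]⟩

/-- Coordinates of the enumeration. [folklore] -/
theorem coe_stdIntLatticeEquiv (k : Fin N → ℤ) (j : Fin N) :
    ((stdIntLatticeEquiv N k : stdIntLattice N) : EuclideanSpace ℝ (Fin N)) j = k j := by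
  simp [stdIntLatticeEquiv, intVecToEuclidean_apply]

/-- The real inner product of `ℝᴺ` in coordinates. [folklore] -/
theorem inner_eq_sum (x y : EuclideanSpace ℝ (Fin N)) : ⟪x, y⟫_ℝ = ∑ j, x j * y j := by
  rw [PiLp.inner_apply]
  exact Finset.sum_congr rfl fun j _ => by simp [mul_comm]

/-- **`ℤᴺ` is self-dual.** [folklore] -/
theorem dualLattice_stdIntLattice (N : ℕ) : dualLattice (stdIntLattice N) = stdIntLattice N := by
  ext x
  rw [mem_dualLattice, mem_stdIntLattice_iff]
  constructor
  · intro h j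
    obtain ⟨n, hn⟩ := h _ (intVecToEuclidean_mem_stdIntLattice N (Pi.single j 1))
    refine ⟨n, ?_⟩
    rw [hn, inner_eq_sum, Finset.sum_eq_single j]
    · simp [intVecToEuclidean_apply]
    · intro b _ hb; simp [intVecToEuclidean_apply, Pi.single_eq_of_ne hb]
    · intro hj; exact absurd (Finset.mem_univ j) hj
  · intro h y hy
    choose kx hkx using h
    choose ky hky using (mem_stdIntLattice_iff y).1 hy
    refine ⟨∑ j, kx j * ky j, ?_⟩
    rw [inner_eq_sum]
    push_cast
    exact Finset.sum_congr rfl fun j _ => by rw [hkx j, hky j]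

/-- **`covol(ℤᴺ) = 1`.** [folklore] -/
theorem covolume_stdIntLattice (N : ℕ) : ZLattice.covolume (stdIntLattice N) = 1 := by
  rw [stdIntLattice, covolume_span_eq_abs_det]
  have h : (Matrix.of fun i j => ((EuclideanSpace.basisFun (Fin N) ℝ).toBasis i) j) =
      (1 : Matrix (Fin N) (Fin N) ℝ) := by
    ext i j
    simp [Matrix.one_apply, eq_comm]
  rw [h, Matrix.det_one, abs_one]

/-! ### The anisotropic Gaussian and its Fourier transform -/

variable {P : Matrix (Fin N) (Fin N) ℝ}

/-- The anisotropic Gaussian `g_{P,m}(v) = e^{-½ (v-m)ᵀP(v-m)}` on `ℝᴺ`. [folklore] -/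
def gauss (P : Matrix (Fin N) (Fin N) ℝ) (m v : EuclideanSpace ℝ (Fin N)) : ℝ :=
  Real.exp (-(ofLp (v - m) ⬝ᵥ P *ᵥ ofLp (v - m)) / 2)

/-- `g_{P,m}` is the (real version of the) Gaussian weight of `GaussianToolkit` translated by `m`.
[folklore] -/
theorem gauss_eq_toReal_gaussWeight (P : Matrix (Fin N) (Fin N) ℝ) (m v : EuclideanSpace ℝ (Fin N)) :
    gauss P m v = (gaussWeight P (v - m)).toReal := by
  rw [gaussWeight, ENNReal.toReal_ofReal (Real.exp_nonneg _), gauss]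

/-- `g_{P,m}` is continuous. [folklore] -/
theorem continuous_gauss (P : Matrix (Fin N) (Fin N) ℝ) (m : EuclideanSpace ℝ (Fin N)) :
    Continuous (gauss P m) := by
  unfold gauss
  refine Real.continuous_exp.comp ((Continuous.neg ?_).div_const _)
  have h1 : Continuous fun v : EuclideanSpace ℝ (Fin N) => (ofLp (v - m) : Fin N → ℝ) :=
    (PiLp.continuous_ofLp 2 _).comp (continuous_id.sub continuous_const)
  exact h1.dotProduct (continuous_const.matrix_mulVec h1)

/-- `g_{P,m}` is positive. [folklore] -/
theorem gauss_pos (P : Matrix (Fin N) (Fin N) ℝ) (m v : EuclideanSpace ℝ (Fin N)) : 0 < gauss P m v :=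
  Real.exp_pos _

/-- The translate of the centred multivariate Gaussian is the multivariate Gaussian with mean `m`.
[folklore] -/
theorem multivariateGaussian_zero_map_add (m : EuclideanSpace ℝ (Fin N)) (S : Matrix (Fin N) (Fin N) ℝ) :
    (multivariateGaussian 0 S).map (fun x => x + m) = multivariateGaussian m S := by
  simp only [multivariateGaussian, zero_add]
  rw [Measure.map_map (measurable_add_const m) (by fun_prop)]
  congr 1
  funext x
  simp [Function.comp, add_comm]

/-- **Integration against the anisotropic Gaussian is `Z_P` times the expectation in the
multivariate Gaussian `N(m, P⁻¹)`** (for continuous integrands). [folklore] -/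
theorem integral_gauss_mul (hP : P.PosDef) (m : EuclideanSpace ℝ (Fin N))
    {φ : EuclideanSpace ℝ (Fin N) → ℂ} (hφ : Continuous φ) :
    ∫ v, (gauss P m v : ℂ) * φ v = (gaussZ P).toReal * ∫ v, φ v ∂(multivariateGaussian m P⁻¹) := by
  obtain ⟨hν, hZ0, hZtop⟩ := multivariateGaussian_inv_eq_withDensity hP
  have hZ : (gaussZ P).toReal * ((gaussZ P)⁻¹).toReal = 1 := by
    rw [ENNReal.toReal_inv, mul_inv_cancel₀ (ENNReal.toReal_ne_zero.2 ⟨hZ0, hZtop⟩)]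
  have hfin : ∀ᵐ x ∂(volume : Measure (EuclideanSpace ℝ (Fin N))), gaussWeight P x < ∞ :=
    Eventually.of_forall fun x => by simp [gaussWeight]
  calc ∫ v, (gauss P m v : ℂ) * φ v
      = ∫ v, (gaussWeight P (v - m)).toReal • φ v := by
        refine integral_congr_ae (Eventually.of_forall fun v => ?_)
        simp only [gauss_eq_toReal_gaussWeight, real_smul]
    _ = ∫ x, (gaussWeight P x).toReal • φ (x + m) := by
        rw [← integral_add_right_eq_self (fun v => (gaussWeight P (v - m)).toReal • φ v) m]
        simp
    _ = ∫ x, φ (x + m) ∂(volume.withDensity (gaussWeight P)) := by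
        rw [integral_withDensity_eq_integral_toReal_smul (measurable_gaussWeight P) hfin]
    _ = (gaussZ P).toReal * (((gaussZ P)⁻¹).toReal * ∫ x, φ (x + m) ∂(volume.withDensity (gaussWeight P))) := by
        rw [← mul_assoc, ← Complex.ofReal_mul, hZ, Complex.ofReal_one, one_mul]
    _ = (gaussZ P).toReal * ∫ x, φ (x + m) ∂(multivariateGaussian 0 P⁻¹) := by
        rw [hν, integral_smul_measure, Complex.real_smul]
    _ = (gaussZ P).toReal * ∫ v, φ v ∂(multivariateGaussian m P⁻¹) := by
        rw [← multivariateGaussian_zero_map_add m,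
          integral_map (measurable_add_const m).aemeasurable hφ.aestronglyMeasurable]

/-- The modulus bound behind the dual side: `P ≤ C` gives `e^{-2π² wᵀP⁻¹w} ≤ e^{-2π²‖w‖²/C}`. [folklore] -/
theorem exp_neg_form_inv_le (hP : P.PosDef) {c C : ℝ} (hc : 0 < c)
    (hlow : ∀ v : Fin N → ℝ, c * ‖(toLp 2 v : EuclideanSpace ℝ (Fin N))‖ ^ 2 ≤ v ⬝ᵥ P *ᵥ v)
    (hup : ∀ v : Fin N → ℝ, v ⬝ᵥ P *ᵥ v ≤ C * ‖(toLp 2 v : EuclideanSpace ℝ (Fin N))‖ ^ 2)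
    (w : EuclideanSpace ℝ (Fin N)) :
    Real.exp (-2 * π ^ 2 * (ofLp w ⬝ᵥ P⁻¹ *ᵥ ofLp w)) ≤ Real.exp (-2 * π ^ 2 * (C⁻¹ * ‖w‖ ^ 2)) := by
  refine Real.exp_le_exp.2 ?_
  have h := (inv_form_bounds hP hc hlow hup (ofLp w)).1
  rw [toLp_ofLp] at h
  nlinarith [Real.pi_pos, sq_nonneg π]

/-- **The Fourier transform of the anisotropic Gaussian**:
`𝓕 g_{P,m}(w) = Z_P e^{-2π² wᵀP⁻¹w} e^{-2πi ⟪w, m⟫}`. [folklore] -/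
theorem fourier_gauss (hP : P.PosDef) (m w : EuclideanSpace ℝ (Fin N)) :
    𝓕 (fun v => (gauss P m v : ℂ)) w =
      (gaussZ P).toReal * (Real.exp (-2 * π ^ 2 * (ofLp w ⬝ᵥ P⁻¹ *ᵥ ofLp w)) : ℂ) *
        Complex.exp ((-(2 * π * ⟪w, m⟫_ℝ) : ℝ) * I) := by
  have hS : (P⁻¹).PosSemidef := hP.inv.posSemidef
  -- the Fourier integral as a Gaussian integral of a character
  have h1 : 𝓕 (fun v => (gauss P m v : ℂ)) w =
      ∫ v, (gauss P m v : ℂ) * Complex.exp (⟪v, (-(2 * π)) • w⟫_ℝ * I) := by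
    rw [Real.fourier_eq']
    refine integral_congr_ae (Eventually.of_forall fun v => ?_)
    simp only [smul_eq_mul, inner_smul_right, mul_comm (gauss P m v : ℂ)]
    congr 2
    push_cast
    ring
  have hφ : Continuous fun v : EuclideanSpace ℝ (Fin N) => Complex.exp (⟪v, (-(2 * π)) • w⟫_ℝ * I) := by
    fun_prop
  rw [h1, integral_gauss_mul hP m hφ, ← charFun_apply, charFun_multivariateGaussian hS, mul_assoc]
  congr 1
  rw [Complex.ofReal_exp, ← Complex.exp_add]
  congr 1
  have hform : (ofLp ((-(2 * π)) • w) ⬝ᵥ P⁻¹ *ᵥ ofLp ((-(2 * π)) • w) : ℝ) =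
      (2 * π) ^ 2 * (ofLp w ⬝ᵥ P⁻¹ *ᵥ ofLp w) := by
    rw [ofLp_smul, Matrix.mulVec_smul, smul_dotProduct, dotProduct_smul, smul_eq_mul, smul_eq_mul]
    ring
  simp only [real_inner_smul_left, hform, real_inner_comm m w]
  push_cast
  ring

/-- Decay of the anisotropic Gaussian: it is dominated by an isotropic Gaussian. [folklore] -/
theorem gauss_le_gaussianFunction {c : ℝ} (hc : 0 < c)
    (hlow : ∀ v : Fin N → ℝ, c * ‖(toLp 2 v : EuclideanSpace ℝ (Fin N))‖ ^ 2 ≤ v ⬝ᵥ P *ᵥ v)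
    (m v : EuclideanSpace ℝ (Fin N)) :
    gauss P m v ≤ gaussianFunction (Real.sqrt (2 * π / c)) (v - m) := by
  rw [gauss, gaussianFunction, Real.sq_sqrt (by positivity)]
  refine Real.exp_le_exp.2 ?_
  have h := hlow (ofLp (v - m))
  rw [toLp_ofLp] at h
  have hc' : -π * ‖v - m‖ ^ 2 / (2 * π / c) = -(c * ‖v - m‖ ^ 2) / 2 := by
    field_simp
  rw [hc']
  linarith

/-- Summability of the primal side `∑_{k ∈ ℤᴺ} e^{-½(k-m)ᵀP(k-m)}`. [folklore] -/
theorem summable_gauss_stdIntLattice {c : ℝ} (hc : 0 < c)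
    (hlow : ∀ v : Fin N → ℝ, c * ‖(toLp 2 v : EuclideanSpace ℝ (Fin N))‖ ^ 2 ≤ v ⬝ᵥ P *ᵥ v)
    (m : EuclideanSpace ℝ (Fin N)) :
    Summable fun g : stdIntLattice N => gauss P m (g : EuclideanSpace ℝ (Fin N)) := by
  have hs : Real.sqrt (2 * π / c) ≠ 0 := (Real.sqrt_pos.2 (by positivity)).ne'
  refine (summable_gaussianFunction_sub (stdIntLattice N) hs m).of_nonneg_of_le
    (fun g => (gauss_pos P m _).le) fun g => gauss_le_gaussianFunction hc hlow m _

/-! ### The theta transformation -/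

/-- **The theta transformation, complex form**: Poisson summation over `ℤᴺ` for the anisotropic
Gaussian, `∑_{k} g_{P,m}(k) = Z_P ∑_{ρ} e^{-2π² ρᵀP⁻¹ρ} e^{-2πi ⟪ρ, m⟫}`.
[cite: FrohlichSpencerCMP1982, §2.6 (2.37)–(2.40) (Poisson summation in the dual variables)] -/
theorem tsum_gauss_eq_complex (hP : P.PosDef) {c C : ℝ} (hc : 0 < c) (hC : 0 < C)
    (hlow : ∀ v : Fin N → ℝ, c * ‖(toLp 2 v : EuclideanSpace ℝ (Fin N))‖ ^ 2 ≤ v ⬝ᵥ P *ᵥ v)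
    (hup : ∀ v : Fin N → ℝ, v ⬝ᵥ P *ᵥ v ≤ C * ‖(toLp 2 v : EuclideanSpace ℝ (Fin N))‖ ^ 2)
    (m : EuclideanSpace ℝ (Fin N)) :
    ∑' g : stdIntLattice N, (gauss P m (g : EuclideanSpace ℝ (Fin N)) : ℂ) =
      ∑' g : stdIntLattice N, (gaussZ P).toReal *
        (Real.exp (-2 * π ^ 2 * (ofLp (g : EuclideanSpace ℝ (Fin N)) ⬝ᵥ P⁻¹ *ᵥ ofLp (g : EuclideanSpace ℝ (Fin N)))) : ℂ) *
          Complex.exp ((-(2 * π * ⟪(g : EuclideanSpace ℝ (Fin N)), m⟫_ℝ) : ℝ) * I) := by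
  -- hypotheses of the Poisson summation formula
  set s := Real.sqrt (2 * π / c) with hsdef
  have hs : 0 < s := Real.sqrt_pos.2 (by positivity)
  have hb : (Module.finrank ℝ (EuclideanSpace ℝ (Fin N)) : ℝ) < (Module.finrank ℝ (EuclideanSpace ℝ (Fin N)) : ℝ) + 1 := by
    linarith
  have hb0 : (0 : ℝ) ≤ (Module.finrank ℝ (EuclideanSpace ℝ (Fin N)) : ℝ) + 1 := by positivity
  have hcont : Continuous fun v : EuclideanSpace ℝ (Fin N) => (gauss P m v : ℂ) :=
    continuous_ofReal.comp (continuous_gauss P m)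
  have hdec : ∀ v : EuclideanSpace ℝ (Fin N), ‖(gauss P m v : ℂ)‖ ≤
      Real.exp ((Module.finrank ℝ (EuclideanSpace ℝ (Fin N)) + 1) ^ 2 / (4 * (π / s ^ 2))) *
        (1 + ‖m‖) ^ ((Module.finrank ℝ (EuclideanSpace ℝ (Fin N)) : ℝ) + 1) *
        (1 + ‖v‖) ^ (-((Module.finrank ℝ (EuclideanSpace ℝ (Fin N)) : ℝ) + 1)) := by
    intro v
    refine le_trans ?_ (norm_coe_gaussianFunction_sub_le hs m hb0 v)
    rw [Complex.norm_real, Complex.norm_real, Real.norm_of_nonneg (gauss_pos P m v).le,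
      Real.norm_of_nonneg (gaussianFunction_pos _ _).le]
    exact gauss_le_gaussianFunction hc hlow m v
  -- the dual side is summable: Gaussian decay of the Fourier transform
  have hsum : Summable fun g' : dualLattice (stdIntLattice N) =>
      𝓕 (fun v => (gauss P m v : ℂ)) (g' : EuclideanSpace ℝ (Fin N)) := by
    refine Summable.of_norm ?_
    have hs' : Real.sqrt (C / (2 * π)) ≠ 0 := (Real.sqrt_pos.2 (by positivity)).ne'
    have hS := (summable_gaussianFunction_sub (dualLattice (stdIntLattice N)) hs' 0).mul_left
      (gaussZ P).toReal
    refine hS.of_nonneg_of_le (fun _ => norm_nonneg _) fun g' => ?_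
    rw [fourier_gauss hP m, norm_mul, norm_mul, Complex.norm_real, Complex.norm_real,
      Real.norm_of_nonneg ENNReal.toReal_nonneg, Real.norm_of_nonneg (Real.exp_nonneg _),
      Complex.norm_exp_ofReal_mul_I, mul_one, sub_zero]
    refine mul_le_mul_of_nonneg_left ?_ ENNReal.toReal_nonneg
    refine (exp_neg_form_inv_le hP hc hlow hup _).trans (le_of_eq ?_)
    rw [gaussianFunction, Real.sq_sqrt (by positivity)]
    congr 1
    field_simp
  have key := Literature.NumberTheory.LFunctions.Fourier.tsum_eq_tsum_fourier_of_rpow_decay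
    (stdIntLattice N) hcont hb hdec hsum
  rw [key, covolume_stdIntLattice, inv_one, one_smul]
  -- re-index the dual sum over `ℤᴺ* = ℤᴺ` and insert the Fourier transform
  have hiff : ∀ x : EuclideanSpace ℝ (Fin N), x ∈ dualLattice (stdIntLattice N) ↔ x ∈ stdIntLattice N :=
    fun x => by rw [dualLattice_stdIntLattice N]
  rw [← (Equiv.subtypeEquivRight hiff).tsum_eq]
  refine tsum_congr fun g' => ?_
  rw [fourier_gauss hP m, Equiv.subtypeEquivRight_apply_coe]

/-- Summability of the dual family `Z_P e^{-2π² wᵀP⁻¹w} e^{-2πi⟪w,m⟫}` over `ℤᴺ`. [folklore] -/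
theorem summable_dual_complex (hP : P.PosDef) {c C : ℝ} (hc : 0 < c) (hC : 0 < C)
    (hlow : ∀ v : Fin N → ℝ, c * ‖(toLp 2 v : EuclideanSpace ℝ (Fin N))‖ ^ 2 ≤ v ⬝ᵥ P *ᵥ v)
    (hup : ∀ v : Fin N → ℝ, v ⬝ᵥ P *ᵥ v ≤ C * ‖(toLp 2 v : EuclideanSpace ℝ (Fin N))‖ ^ 2)
    (m : EuclideanSpace ℝ (Fin N)) :
    Summable fun g : stdIntLattice N => ((gaussZ P).toReal : ℂ) *
      (Real.exp (-2 * π ^ 2 * (ofLp (g : EuclideanSpace ℝ (Fin N)) ⬝ᵥ P⁻¹ *ᵥ ofLp (g : EuclideanSpace ℝ (Fin N)))) : ℂ) *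
        Complex.exp ((-(2 * π * ⟪(g : EuclideanSpace ℝ (Fin N)), m⟫_ℝ) : ℝ) * I) := by
  refine Summable.of_norm ?_
  have hs' : Real.sqrt (C / (2 * π)) ≠ 0 := (Real.sqrt_pos.2 (by positivity)).ne'
  have hS := (summable_gaussianFunction_sub (stdIntLattice N) hs' 0).mul_left (gaussZ P).toReal
  refine hS.of_nonneg_of_le (fun _ => norm_nonneg _) fun g => ?_
  rw [norm_mul, norm_mul, Complex.norm_real, Complex.norm_real, Real.norm_of_nonneg ENNReal.toReal_nonneg,
    Real.norm_of_nonneg (Real.exp_nonneg _), Complex.norm_exp_ofReal_mul_I, mul_one, sub_zero]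
  refine mul_le_mul_of_nonneg_left ?_ ENNReal.toReal_nonneg
  refine (exp_neg_form_inv_le hP hc hlow hup _).trans (le_of_eq ?_)
  rw [gaussianFunction, Real.sq_sqrt (by positivity)]
  congr 1
  try field_simp

/-- Coordinates of `k - m` for an integer vector `k`. [folklore] -/
theorem ofLp_stdIntLatticeEquiv_sub (k : Fin N → ℤ) (m : Fin N → ℝ) :
    ofLp (((stdIntLatticeEquiv N k : stdIntLattice N) : EuclideanSpace ℝ (Fin N)) - toLp 2 m) =
      fun j => (k j : ℝ) - m j := by
  funext j
  rw [ofLp_sub, Pi.sub_apply, ofLp_toLp]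
  exact congrArg (· - m j) (coe_stdIntLatticeEquiv k j)

/-- Coordinates of an integer vector. [folklore] -/
theorem ofLp_stdIntLatticeEquiv (k : Fin N → ℤ) :
    ofLp (((stdIntLatticeEquiv N k : stdIntLattice N) : EuclideanSpace ℝ (Fin N))) = fun j => (k j : ℝ) := by
  funext j
  exact coe_stdIntLatticeEquiv k j

/-- **The theta transformation** (Poisson summation over `ℤᴺ` for the anisotropic Gaussian, real
form): for a positive definite `P` with `c ≤ P ≤ C` (`0 < c`, `0 < C`) and every centre `m ∈ ℝᴺ`,
`∑_{k ∈ ℤᴺ} e^{-½ (k-m)ᵀP(k-m)} = Z_P ∑_{ρ ∈ ℤᴺ} e^{-2π² ρᵀP⁻¹ρ} cos(2π ρ·m)`, `Z_P = ∫ e^{-½ yᵀPy}dy`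
(`GaussianToolkit.gaussZ`; in ratios of such sums it cancels).
[cite: FrohlichSpencerCMP1982, §2.5 (2.33)–(2.36) with §2.6 (2.37)–(2.40)] -/
theorem tsum_exp_neg_half_form_sub_eq (hP : P.PosDef) {c C : ℝ} (hc : 0 < c) (hC : 0 < C)
    (hlow : ∀ v : Fin N → ℝ, c * ‖(toLp 2 v : EuclideanSpace ℝ (Fin N))‖ ^ 2 ≤ v ⬝ᵥ P *ᵥ v)
    (hup : ∀ v : Fin N → ℝ, v ⬝ᵥ P *ᵥ v ≤ C * ‖(toLp 2 v : EuclideanSpace ℝ (Fin N))‖ ^ 2)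
    (m : Fin N → ℝ) :
    ∑' k : Fin N → ℤ, Real.exp (-((fun j => (k j : ℝ) - m j) ⬝ᵥ P *ᵥ (fun j => (k j : ℝ) - m j)) / 2) =
      (gaussZ P).toReal * ∑' ρ : Fin N → ℤ,
        Real.exp (-2 * π ^ 2 * ((fun j => (ρ j : ℝ)) ⬝ᵥ P⁻¹ *ᵥ fun j => (ρ j : ℝ))) *
          Real.cos (2 * π * ∑ j, (ρ j : ℝ) * m j) := by
  set mE : EuclideanSpace ℝ (Fin N) := toLp 2 m with hmE
  have hcx := tsum_gauss_eq_complex hP hc hC hlow hup mE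
  rw [← (stdIntLatticeEquiv N).tsum_eq, ← (stdIntLatticeEquiv N).tsum_eq (f := fun g => _ * _ * _)] at hcx
  -- real parts
  have hsumC : Summable fun k : Fin N → ℤ => ((gaussZ P).toReal : ℂ) *
      (Real.exp (-2 * π ^ 2 * (ofLp ((stdIntLatticeEquiv N k : stdIntLattice N) : EuclideanSpace ℝ (Fin N)) ⬝ᵥ P⁻¹ *ᵥ
        ofLp ((stdIntLatticeEquiv N k : stdIntLattice N) : EuclideanSpace ℝ (Fin N)))) : ℂ) *
        Complex.exp ((-(2 * π * ⟪((stdIntLatticeEquiv N k : stdIntLattice N) : EuclideanSpace ℝ (Fin N)), mE⟫_ℝ) : ℝ) * I) := by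
    simpa only [Function.comp_def] using
      (summable_dual_complex hP hc hC hlow hup mE).comp_injective (stdIntLatticeEquiv N).injective
  have hre := congrArg Complex.re hcx
  rw [Complex.re_tsum hsumC] at hre
  have hL : ∀ k : Fin N → ℤ, (gauss P mE ((stdIntLatticeEquiv N k : stdIntLattice N) : EuclideanSpace ℝ (Fin N)) : ℂ) =
      (Real.exp (-((fun j => (k j : ℝ) - m j) ⬝ᵥ P *ᵥ (fun j => (k j : ℝ) - m j)) / 2) : ℂ) := by
    intro k
    rw [gauss, ofLp_stdIntLatticeEquiv_sub]
  simp only [hL, ← Complex.ofReal_tsum, Complex.ofReal_re] at hre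
  rw [hre, ← tsum_mul_left]
  refine tsum_congr fun ρ => ?_
  simp only [Complex.re_ofReal_mul, Complex.exp_ofReal_mul_I_re, ofLp_stdIntLatticeEquiv,
    inner_eq_sum, coe_stdIntLatticeEquiv, Real.cos_neg, mul_assoc]
  congr 2
  try simp [hmE]

end GaussianPoisson

end Literature.MathematicalPhysics.QuantumFieldTheory
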